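import Summits.QuantumFields.YangMills.Theorems.UnitScaleTiltProp7InverseDiffFirstOrder
import Summits.QuantumFields.YangMills.Theorems.UnitScaleTiltProp7ProjRangeKernelDecayCoarseGram
import Mathlib.Analysis.CStarAlgebra.Matrix
import Mathlib.Analysis.InnerProductSpace.PiL2
import HarnessLib

/-!
# Route `UnitScaleTilt`, crux K1 «MinimiserStabilityRegPr» (stmt-QuantumFields-19200), EX row `hGF[Lift]` (curved member) — **LOD LINE, PEN (L5″) FILE 1 (ABSTRACT):
# PROJECTOR PERTURBATION BOOKKEEPING — `P = B M⁻¹ Bᴴ`, `M = BᴴB`, MOVES IN OPERATOR NORM BY `O(‖B − B′‖)` WITH CONSTANTS POLYNOMIAL IN `(‖B‖, ‖B′‖, m₀⁻¹, m₀′⁻¹)`**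

Cell `ym3-torus` (HUMAN RULING D-0037, YM ladder rung R3 — NOT d = 4, NOT infinite volume, NOT a mass gap, NOT Clay).  Width seat `ym-routeR-w3` gen 12
(D-0154 (3c); ★p1 g24 LOCATE-L6-ASSEMBLY v1 §1 Step I.2 «HANDS WANTED (L5″)», CLAIM 2026-08-29 22:55:33Z).  THEOREMS ONLY (0 `def`, 0 `sorry`), Mathlib's scoped
`L²`-operator norm on rectangular matrices (`Matrix.Norms.L2Operator`) + the chair's engines ✓`Prop7InverseDiffFirstOrder` (p748261: `inv_sub_inv_eq`,
`norm_inv_sub_inv_mulVec_le`), ✓`Prop7AccretiveConjOperatorBound` (p747790: `sum_normSq_inv_mulVec_le_of_accretive`), ✓`Prop7ProjRangeKernelDecayCoarseGram`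
(p746782: `accretive_gram_of_coercive`, letters `hM : M = Bᴴ * B`, `hP : P = B * M⁻¹ * Bᴴ`); `--supports stmt-QuantumFields-19200 --as helper`, count-neutral.
HONEST LABEL (★★OWNER RULING №33 (6)): curved γ-row supplier line (LOD localisation), pen (L5″) «local comparison of the nonlocal term `D_U P_U D*_U`»;
this file is its ABSTRACT layer only — nothing of (3.49), Thm 3.1∕3.3, `h349`, `hGF`, EX ∕ 19200 is proved here; the MEMBER file (tails `e^{−μ(R″−R′)}` from the
landed decay rows + this bookkeeping at `δ_G :=` ✓p748261) is FILE 2.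

WHY.  In Organisation I of LOCATE-L6-ASSEMBLY the nonlocal term of the curved Hessian is `⟨A, D_U P_U D*_U A⟩` with `P_U = B M⁻¹ Bᴴ`, `B = G_a Q″†`
(coarse → fine), `M = BᴴB = Q″G_a²Q″†` (✓p746782).  Step I.2 (L5″) compares `P_U` on a cube in axial gauge with the flat `P_1`: the massive propagators differ
by a FIRST-ORDER-small perturbation, so `‖G_a(U^g) − G_a(1)‖ ≤ δ_G = O(ε₀R″)` in operator norm (✓p748261 `norm_inv_sub_inv_mulVec_le`), and the averaging
adjoints differ by `‖Q″(U^g)† − Q″(1)†‖ ≤ δ_T` (ROW-T class).  This file turns those two numbers into `‖P_U − P_1‖ ≤ C·(‖G‖δ_T + δ_G‖Q″†‖)` with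
`C = m₀⁻¹‖B‖ + m₀′⁻¹‖B′‖ + ‖B‖‖B′‖m₀⁻¹m₀′⁻¹(‖B‖ + ‖B′‖)` — every constant a polynomial in the operator norms and the coarse-Gram coercivity constants
(brick (L4′): `m₀ = m_B²`), NO dimension, NO volume, NO `η`: K-uniform by construction.

WHAT IS PROVED (ns `Summit.QuantumFields.YangMills.Theorems.Prop7ProjectorPerturbation`; `B B′ : Matrix n m ℂ` fine × coarse, `‖·‖` = Mathlib's `L²`-operator norm).
* §0 CURRENCY BRIDGES between the chair's `Real.sqrt (Σ‖·‖²)` rows and the operator norm: `sqrt_sum_normSq_eq_norm_toLp`, `sqrt_normSq_mulVec_le`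
  (`‖Av‖₂ ≤ ‖A‖·‖v‖₂`), `l2_opNorm_le_of_forall_sqrt_le` (pointwise row ⟹ `‖A‖ ≤ C`), ★ `l2_opNorm_inv_le_of_accretive` (`m₀`-accretive ⟹ `IsUnit M.det ∧ ‖M⁻¹‖ ≤ m₀⁻¹`,
  ✓p747790), ★ `l2_opNorm_inv_sub_inv_le_of_firstOrder` (✓p748261's conclusion AS AN OPERATOR-NORM ROW: `‖A⁻¹ − B⁻¹‖ ≤ m_A⁻¹(c₁√(m_B⁻¹) + c₀m_B⁻¹)`).
* §1 GRAM ∕ INVERSE-GRAM: ★ `norm_gram_sub_gram_le` (`‖BᴴB − B′ᴴB′‖ ≤ (‖B‖ + ‖B′‖)‖B − B′‖`), ★ `norm_inv_sub_inv_le`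
  (`‖M⁻¹ − M′⁻¹‖ ≤ ‖M⁻¹‖‖M′⁻¹‖‖M − M′‖`, second resolvent identity ✓`inv_sub_inv_eq`), ★ `l2_opNorm_gram_inv_le_of_coercive` (`m₀Σ‖c‖² ≤ Σ‖(Bc)‖²` ⟹
  `IsUnit (BᴴB).det ∧ ‖(BᴴB)⁻¹‖ ≤ m₀⁻¹`).
* §2 PROJECTOR: `proj_sub_proj_eq` (three-term telescope), ★★ `norm_proj_sub_proj_le`, ★★★ `norm_proj_sub_proj_le_of_coercive`
  (`‖P − P′‖ ≤ δ·(m₀⁻¹b + m₀′⁻¹b′ + b b′ m₀⁻¹m₀′⁻¹(b + b′))` for `‖B‖ ≤ b`, `‖B′‖ ≤ b′`, `‖B − B′‖ ≤ δ`).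
* §3 THE `B = G T` LAYER: `mul_sub_mul_eq`, ★ `norm_mul_sub_mul_le` (`‖GT − G′T′‖ ≤ ‖G‖‖T − T′‖ + ‖G − G′‖‖T′‖`).
* §4 BACK TO ROWS: `norm_sum_star_mul_le_sqrt_mul_sqrt`, ★ `norm_sum_star_mul_mulVec_le` (`|Σ f̄_i (X g)_i| ≤ ‖X‖·‖f‖₂·‖g‖₂` — the bilinear currency of Step I.2, `X := P − P′`, `f, g := D*A_j`).

References: T. Bałaban, CMP **99** (1985) 389–434 [Balaban1985BackgroundPropagators] ((3.20)–(3.23) p.394 (the projectors `R`, `P = 1 − R` through `G` and `Q*`),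
(3.105) p.414 (resolvent identities), Thm 3.3 p.399); T. Kato, *Perturbation theory for linear operators* (1966) I §4.4, IV §1 (second resolvent identity,
perturbation of projections) [folklore].
-/

set_option autoImplicit false

noncomputable section

open scoped Matrix ComplexConjugate BigOperators Matrix.Norms.L2Operator
open Finset

namespace Summit.QuantumFields.YangMills.Theorems.Prop7ProjectorPerturbation

open Summit.QuantumFields.YangMills.Theorems.Prop7AccretiveConjOperatorBound (sum_normSq_inv_mulVec_le_of_accretive)
open Summit.QuantumFields.YangMills.Theorems.Prop7InverseDiffFirstOrder (inv_sub_inv_eq norm_inv_sub_inv_mulVec_le)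
open Summit.QuantumFields.YangMills.Theorems.Prop7ProjRangeKernelDecayCoarseGram (accretive_gram_of_coercive)

variable {n m : Type*} [Fintype n] [Fintype m] [DecidableEq n] [DecidableEq m]

/-! ## §0 Currency bridges: `Real.sqrt (Σ‖·‖²)` rows ↔ the `L²`-operator norm -/

omit [DecidableEq n] in
/-- The chair's `ℓ²` currency is the Euclidean norm: `√(Σ_i ‖v_i‖²) = ‖toLp 2 v‖`. [folklore] -/
theorem sqrt_sum_normSq_eq_norm_toLp (v : n → ℂ) : Real.sqrt (∑ i, ‖v i‖ ^ 2) = ‖(WithLp.toLp 2 v : EuclideanSpace ℂ n)‖ := by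
  rw [EuclideanSpace.norm_eq]

omit [DecidableEq m] in
/-- Operator norm ⟹ row: `√(Σ_i ‖(A v)_i‖²) ≤ ‖A‖·√(Σ_j ‖v_j‖²)`. [folklore] -/
theorem sqrt_normSq_mulVec_le (A : Matrix m n ℂ) (v : n → ℂ) :
    Real.sqrt (∑ i, ‖(A *ᵥ v) i‖ ^ 2) ≤ ‖A‖ * Real.sqrt (∑ j, ‖v j‖ ^ 2) := by
  have h := Matrix.l2_opNorm_mulVec A (WithLp.toLp 2 v)
  rw [sqrt_sum_normSq_eq_norm_toLp, sqrt_sum_normSq_eq_norm_toLp]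
  exact h

omit [DecidableEq m] in
/-- Row ⟹ operator norm: a pointwise bound `√(Σ‖(Av)_i‖²) ≤ C·√(Σ‖v_j‖²)` with `0 ≤ C` gives `‖A‖ ≤ C` (the `Real.sqrt`-currency twin of lit
✓`Literature.Computability.QuantumComplexity.PlaceGateNorm.l2_opNorm_le_of_forall_mulVec`, which takes the row on `EuclideanSpace` vectors; not imported — different cone). [folklore] -/
theorem l2_opNorm_le_of_forall_sqrt_le (A : Matrix m n ℂ) {C : ℝ} (hC : 0 ≤ C)
    (h : ∀ v : n → ℂ, Real.sqrt (∑ i, ‖(A *ᵥ v) i‖ ^ 2) ≤ C * Real.sqrt (∑ j, ‖v j‖ ^ 2)) : ‖A‖ ≤ C := by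
  rw [Matrix.l2_opNorm_def]
  refine ContinuousLinearMap.opNorm_le_bound _ hC fun x => ?_
  have hx := h (WithLp.ofLp x)
  rw [sqrt_sum_normSq_eq_norm_toLp, sqrt_sum_normSq_eq_norm_toLp, WithLp.toLp_ofLp] at hx
  exact hx

/-- ★ **ACCRETIVE ⟹ OPERATOR-BOUNDED INVERSE**: an `m₀`-accretive square matrix (`m₀ > 0`) is invertible with `‖M⁻¹‖ ≤ m₀⁻¹` (✓`sum_normSq_inv_mulVec_le_of_accretive`
read as an operator-norm row). [cite: Balaban1985BackgroundPropagators, Thm 3.1 p.397] -/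
theorem l2_opNorm_inv_le_of_accretive (M : Matrix m m ℂ) {m₀ : ℝ} (hm₀ : 0 < m₀)
    (hacc : ∀ v : m → ℂ, m₀ * ∑ i, ‖v i‖ ^ 2 ≤ (∑ i, star (v i) * (M *ᵥ v) i).re) :
    IsUnit M.det ∧ ‖M⁻¹‖ ≤ m₀⁻¹ := by
  refine ⟨(sum_normSq_inv_mulVec_le_of_accretive M hm₀ hacc 0).1, l2_opNorm_le_of_forall_sqrt_le _ (by positivity) fun v => ?_⟩
  have h := Real.sqrt_le_sqrt (sum_normSq_inv_mulVec_le_of_accretive M hm₀ hacc v).2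
  rw [Real.sqrt_mul (by positivity), Real.sqrt_sq (by positivity)] at h
  exact h

/-- ★ **✓p748261 AS AN OPERATOR-NORM ROW**: `A` `m_A`-accretive, `B` `m_B`-accretive with the energy identity for `Dm`, `‖(B − A)w‖₂ ≤ c₁‖Dm w‖₂ + c₀‖w‖₂`
(a FIRST-ORDER, not operator-small, perturbation) ⟹ `‖A⁻¹ − B⁻¹‖ ≤ m_A⁻¹·(c₁√(m_B⁻¹) + c₀m_B⁻¹)` — at the member `A, B :=` the massive propagators' inverses
`Δ_{U^g} + aQ″†Q″` vs `Δ_1 + aQ″†Q″`, `c₁, c₀ = O(ε₀R″)`: the number `δ_G` of §3. [cite: Balaban1985BackgroundPropagators, Thm 3.3 p.399, (3.105) p.414] -/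
theorem l2_opNorm_inv_sub_inv_le_of_firstOrder {k : Type*} [Fintype k] (A B : Matrix n n ℂ) (Dm : Matrix k n ℂ) {mA mB c₁ c₀ : ℝ}
    (hmA : 0 < mA) (hmB : 0 < mB) (hc₁ : 0 ≤ c₁) (hc₀ : 0 ≤ c₀)
    (haccA : ∀ v : n → ℂ, mA * ∑ i, ‖v i‖ ^ 2 ≤ (∑ i, star (v i) * (A *ᵥ v) i).re)
    (haccB : ∀ v : n → ℂ, mB * ∑ i, ‖v i‖ ^ 2 ≤ (∑ i, star (v i) * (B *ᵥ v) i).re)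
    (henergy : ∀ w : n → ℂ, ∑ j, ‖(Dm *ᵥ w) j‖ ^ 2 ≤ (∑ i, star (w i) * (B *ᵥ w) i).re)
    (hE : ∀ w : n → ℂ, Real.sqrt (∑ i, ‖((B - A) *ᵥ w) i‖ ^ 2) ≤ c₁ * Real.sqrt (∑ j, ‖(Dm *ᵥ w) j‖ ^ 2) + c₀ * Real.sqrt (∑ i, ‖w i‖ ^ 2)) :
    ‖A⁻¹ - B⁻¹‖ ≤ mA⁻¹ * (c₁ * Real.sqrt mB⁻¹ + c₀ * mB⁻¹) :=
  l2_opNorm_le_of_forall_sqrt_le _ (by positivity) (norm_inv_sub_inv_mulVec_le A B Dm hmA hmB hc₁ hc₀ haccA haccB henergy hE)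

/-! ## §1 Gram and inverse-Gram perturbation -/

/-- ★ **GRAM PERTURBATION (rectangular)**: `‖BᴴB − B′ᴴB′‖ ≤ (‖B‖ + ‖B′‖)·‖B − B′‖` (`BᴴB − B′ᴴB′ = Bᴴ(B − B′) + (B − B′)ᴴB′`, `‖Xᴴ‖ = ‖X‖`,
`‖XY‖ ≤ ‖X‖‖Y‖`) — the coarse × fine twin of the square-matrix row ✓`…BalabanUV.T4Continuum.Support.RegularBackgroundTower.norm_gram_sub_gram_le` (same proof;
not imported — different cone). [folklore] -/
theorem norm_gram_sub_gram_le (B B' : Matrix n m ℂ) : ‖Bᴴ * B - B'ᴴ * B'‖ ≤ (‖B‖ + ‖B'‖) * ‖B - B'‖ := by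
  have e : Bᴴ * B - B'ᴴ * B' = Bᴴ * (B - B') + (B - B')ᴴ * B' := by
    rw [Matrix.conjTranspose_sub, Matrix.mul_sub, Matrix.sub_mul]; abel
  rw [e]
  calc ‖Bᴴ * (B - B') + (B - B')ᴴ * B'‖ ≤ ‖Bᴴ * (B - B')‖ + ‖(B - B')ᴴ * B'‖ := norm_add_le _ _
    _ ≤ ‖Bᴴ‖ * ‖B - B'‖ + ‖(B - B')ᴴ‖ * ‖B'‖ := add_le_add (Matrix.l2_opNorm_mul _ _) (Matrix.l2_opNorm_mul _ _)
    _ = (‖B‖ + ‖B'‖) * ‖B - B'‖ := by rw [Matrix.l2_opNorm_conjTranspose, Matrix.l2_opNorm_conjTranspose]; ring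

/-- ★ **INVERSE PERTURBATION (second resolvent identity)**: for invertible `M, M′`: `‖M⁻¹ − M′⁻¹‖ ≤ ‖M⁻¹‖·‖M′⁻¹‖·‖M − M′‖` (`M⁻¹ − M′⁻¹ = M⁻¹(M′ − M)M′⁻¹`,
✓`Prop7InverseDiffFirstOrder.inv_sub_inv_eq`). [cite: Balaban1985BackgroundPropagators, (3.105) p.414] -/
theorem norm_inv_sub_inv_le (M M' : Matrix m m ℂ) (hM : IsUnit M.det) (hM' : IsUnit M'.det) :
    ‖M⁻¹ - M'⁻¹‖ ≤ ‖M⁻¹‖ * ‖M'⁻¹‖ * ‖M - M'‖ := by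
  rw [inv_sub_inv_eq M M' hM hM']
  calc ‖M⁻¹ * (M' - M) * M'⁻¹‖ ≤ ‖M⁻¹ * (M' - M)‖ * ‖M'⁻¹‖ := Matrix.l2_opNorm_mul _ _
    _ ≤ ‖M⁻¹‖ * ‖M' - M‖ * ‖M'⁻¹‖ := mul_le_mul_of_nonneg_right (Matrix.l2_opNorm_mul _ _) (norm_nonneg _)
    _ = ‖M⁻¹‖ * ‖M'⁻¹‖ * ‖M - M'‖ := by rw [norm_sub_rev]; ring

omit [DecidableEq n] in
/-- ★ **COERCIVE COLUMNS ⟹ OPERATOR-BOUNDED INVERSE GRAM**: `m₀·Σ‖c_y‖² ≤ Σ‖(Bc)_x‖²` (`m₀ > 0`; the (L4′) slot `m₀ = m_B²`) ⟹ `IsUnit (BᴴB).det` and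
`‖(BᴴB)⁻¹‖ ≤ m₀⁻¹` (✓`accretive_gram_of_coercive` + §0). [cite: Balaban1985BackgroundPropagators, Thm 3.1 p.397, (3.21) p.394] -/
theorem l2_opNorm_gram_inv_le_of_coercive (B : Matrix n m ℂ) {M : Matrix m m ℂ} (hM : M = Bᴴ * B) {m₀ : ℝ} (hm₀ : 0 < m₀)
    (hcoer : ∀ c : m → ℂ, m₀ * ∑ y, ‖c y‖ ^ 2 ≤ ∑ x, ‖(B *ᵥ c) x‖ ^ 2) : IsUnit M.det ∧ ‖M⁻¹‖ ≤ m₀⁻¹ :=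
  l2_opNorm_inv_le_of_accretive M hm₀ (accretive_gram_of_coercive B hM hcoer)

/-! ## §2 Projector perturbation -/

omit [Fintype n] [DecidableEq n] [DecidableEq m] in
/-- The three-term telescope: `B N Bᴴ − B′N′B′ᴴ = (B − B′)N Bᴴ + B′(N − N′)Bᴴ + B′N′(B − B′)ᴴ`. [folklore] -/
theorem proj_sub_proj_eq (B B' : Matrix n m ℂ) (N N' : Matrix m m ℂ) :
    B * N * Bᴴ - B' * N' * B'ᴴ = (B - B') * N * Bᴴ + B' * (N - N') * Bᴴ + B' * N' * (B - B')ᴴ := by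
  simp only [Matrix.conjTranspose_sub, Matrix.sub_mul, Matrix.mul_sub]; abel

/-- ★★ **PROJECTOR PERTURBATION, GENERIC MIDDLE FACTORS**: `‖B N Bᴴ − B′N′B′ᴴ‖ ≤ ‖B − B′‖‖N‖‖B‖ + ‖B′‖‖N − N′‖‖B‖ + ‖B′‖‖N′‖‖B − B′‖`. [folklore] -/
theorem norm_proj_sub_proj_le (B B' : Matrix n m ℂ) (N N' : Matrix m m ℂ) :
    ‖B * N * Bᴴ - B' * N' * B'ᴴ‖ ≤ ‖B - B'‖ * ‖N‖ * ‖B‖ + ‖B'‖ * ‖N - N'‖ * ‖B‖ + ‖B'‖ * ‖N'‖ * ‖B - B'‖ := by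
  rw [proj_sub_proj_eq]
  have h3 : ∀ (X : Matrix n m ℂ) (Y : Matrix m m ℂ) (Z : Matrix n m ℂ), ‖X * Y * Zᴴ‖ ≤ ‖X‖ * ‖Y‖ * ‖Z‖ := fun X Y Z =>
    calc ‖X * Y * Zᴴ‖ ≤ ‖X * Y‖ * ‖Zᴴ‖ := Matrix.l2_opNorm_mul _ _
      _ ≤ ‖X‖ * ‖Y‖ * ‖Z‖ := by rw [Matrix.l2_opNorm_conjTranspose]; exact mul_le_mul_of_nonneg_right (Matrix.l2_opNorm_mul _ _) (norm_nonneg _)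
  calc ‖(B - B') * N * Bᴴ + B' * (N - N') * Bᴴ + B' * N' * (B - B')ᴴ‖
      ≤ ‖(B - B') * N * Bᴴ‖ + ‖B' * (N - N') * Bᴴ‖ + ‖B' * N' * (B - B')ᴴ‖ := norm_add₃_le
    _ ≤ _ := add_le_add (add_le_add (h3 _ _ _) (h3 _ _ _)) (h3 _ _ _)

/-- ★★★ **PROJECTOR PERTURBATION FOR `P = B M⁻¹ Bᴴ`, `M = BᴴB` (✓p746782's letters)**: if the columns of `B` and `B′` are `m₀`- resp. `m₀′`-coercive
(`m₀Σ‖c‖² ≤ Σ‖(Bc)‖²`), `‖B‖ ≤ b`, `‖B′‖ ≤ b′` and `‖B − B′‖ ≤ δ`, then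
**`‖P − P′‖ ≤ δ·(m₀⁻¹·b + m₀′⁻¹·b′ + b·b′·(m₀⁻¹·m₀′⁻¹·(b + b′)))`** — constants polynomial in `(b, b′, m₀⁻¹, m₀′⁻¹)`, linear in `δ`; no dimension, no volume.
At the member (Step I.2 (L5″)): `B = G_a(U^g)Q″(U^g)†`, `B′ = G_a(1)Q″(1)†` on the concentric cube, `δ` from §3 with ✓p748261, `m₀ = m_B²` from (L4′).
[cite: Balaban1985BackgroundPropagators, (3.20)–(3.23) p.394, (3.105) p.414] -/
theorem norm_proj_sub_proj_le_of_coercive (B B' : Matrix n m ℂ) {M M' : Matrix m m ℂ} {P P' : Matrix n n ℂ}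
    (hM : M = Bᴴ * B) (hM' : M' = B'ᴴ * B') (hP : P = B * M⁻¹ * Bᴴ) (hP' : P' = B' * M'⁻¹ * B'ᴴ)
    {m₀ m₀' b b' δ : ℝ} (hm₀ : 0 < m₀) (hm₀' : 0 < m₀')
    (hcoer : ∀ c : m → ℂ, m₀ * ∑ y, ‖c y‖ ^ 2 ≤ ∑ x, ‖(B *ᵥ c) x‖ ^ 2)
    (hcoer' : ∀ c : m → ℂ, m₀' * ∑ y, ‖c y‖ ^ 2 ≤ ∑ x, ‖(B' *ᵥ c) x‖ ^ 2)
    (hb : ‖B‖ ≤ b) (hb' : ‖B'‖ ≤ b') (hδ : ‖B - B'‖ ≤ δ) :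
    ‖P - P'‖ ≤ δ * (m₀⁻¹ * b + m₀'⁻¹ * b' + b * b' * (m₀⁻¹ * m₀'⁻¹ * (b + b'))) := by
  obtain ⟨hMu, hMi⟩ := l2_opNorm_gram_inv_le_of_coercive B hM hm₀ hcoer
  obtain ⟨hMu', hMi'⟩ := l2_opNorm_gram_inv_le_of_coercive B' hM' hm₀' hcoer'
  have hb0 : 0 ≤ b := (norm_nonneg _).trans hb
  have hb0' : 0 ≤ b' := (norm_nonneg _).trans hb'
  have hδ0 : 0 ≤ δ := (norm_nonneg _).trans hδ
  -- `‖M − M′‖ ≤ (b + b′) δ`, `‖M⁻¹ − M′⁻¹‖ ≤ m₀⁻¹ m₀′⁻¹ (b + b′) δ`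
  have hMM : ‖M - M'‖ ≤ (b + b') * δ := by
    rw [hM, hM']
    exact (norm_gram_sub_gram_le B B').trans (mul_le_mul (add_le_add hb hb') hδ (norm_nonneg _) (by positivity))
  have hNN : ‖M⁻¹ - M'⁻¹‖ ≤ m₀⁻¹ * m₀'⁻¹ * ((b + b') * δ) :=
    (norm_inv_sub_inv_le M M' hMu hMu').trans
      (mul_le_mul (mul_le_mul hMi hMi' (norm_nonneg _) (by positivity)) hMM (norm_nonneg _) (by positivity))
  have h1 : ‖B - B'‖ * ‖M⁻¹‖ * ‖B‖ ≤ δ * m₀⁻¹ * b :=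
    mul_le_mul (mul_le_mul hδ hMi (norm_nonneg _) hδ0) hb (norm_nonneg _) (by positivity)
  have h2 : ‖B'‖ * ‖M⁻¹ - M'⁻¹‖ * ‖B‖ ≤ b' * (m₀⁻¹ * m₀'⁻¹ * ((b + b') * δ)) * b :=
    mul_le_mul (mul_le_mul hb' hNN (norm_nonneg _) hb0') hb (norm_nonneg _) (by positivity)
  have h3 : ‖B'‖ * ‖M'⁻¹‖ * ‖B - B'‖ ≤ b' * m₀'⁻¹ * δ :=
    mul_le_mul (mul_le_mul hb' hMi' (norm_nonneg _) hb0') hδ (norm_nonneg _) (by positivity)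
  rw [hP, hP']
  calc ‖B * M⁻¹ * Bᴴ - B' * M'⁻¹ * B'ᴴ‖
      ≤ ‖B - B'‖ * ‖M⁻¹‖ * ‖B‖ + ‖B'‖ * ‖M⁻¹ - M'⁻¹‖ * ‖B‖ + ‖B'‖ * ‖M'⁻¹‖ * ‖B - B'‖ := norm_proj_sub_proj_le B B' _ _
    _ ≤ δ * m₀⁻¹ * b + b' * (m₀⁻¹ * m₀'⁻¹ * ((b + b') * δ)) * b + b' * m₀'⁻¹ * δ := add_le_add (add_le_add h1 h2) h3
    _ = δ * (m₀⁻¹ * b + m₀'⁻¹ * b' + b * b' * (m₀⁻¹ * m₀'⁻¹ * (b + b'))) := by ring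

/-! ## §3 The `B = G T` layer (massive propagator × averaging adjoint) -/

omit [Fintype m] [DecidableEq n] [DecidableEq m] in
/-- `GT − G′T′ = G(T − T′) + (G − G′)T′`. [folklore] -/
theorem mul_sub_mul_eq (G G' : Matrix n n ℂ) (T T' : Matrix n m ℂ) : G * T - G' * T' = G * (T - T') + (G - G') * T' := by
  rw [Matrix.mul_sub, Matrix.sub_mul]; abel

/-- ★ **`‖GT − G′T′‖ ≤ ‖G‖·‖T − T′‖ + ‖G − G′‖·‖T′‖`** — at the member `G, G′ := G_a(U^g), G_a(1)` (`‖G − G′‖ ≤ δ_G` by ✓p748261 ∕ §0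
`l2_opNorm_inv_sub_inv_le_of_firstOrder`, `‖G‖ ≤ m⁻¹` by §0 `l2_opNorm_inv_le_of_accretive`), `T, T′ := Q″(U^g)†, Q″(1)†` (`‖T − T′‖ ≤ δ_T`, ROW-T class;
`‖T′‖ ≤ 1` in the coarse-volume currency).  [cite: Balaban1985BackgroundPropagators, (3.20) p.394, (3.105) p.414] -/
theorem norm_mul_sub_mul_le (G G' : Matrix n n ℂ) (T T' : Matrix n m ℂ) : ‖G * T - G' * T'‖ ≤ ‖G‖ * ‖T - T'‖ + ‖G - G'‖ * ‖T'‖ := by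
  rw [mul_sub_mul_eq]
  exact (norm_add_le _ _).trans (add_le_add (Matrix.l2_opNorm_mul _ _) (Matrix.l2_opNorm_mul _ _))

/-! ## §4 Back to rows: the bilinear currency of Step I.2 -/

omit [DecidableEq n] in
/-- Cauchy–Schwarz for the Hermitian pairing with norms: `‖Σ_i f̄_i v_i‖ ≤ √(Σ‖f_i‖²)·√(Σ‖v_i‖²)` (the `Finset.univ` case of lit
✓`Literature.Computability.Cryptography.SLWEToISISReduction.norm_sum_star_mul_le`; `Re`-version: ✓`Prop7AccretiveConjOperatorBound.re_sum_star_mul_le`). [folklore] -/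
theorem norm_sum_star_mul_le_sqrt_mul_sqrt (f v : n → ℂ) : ‖∑ i, star (f i) * v i‖ ≤ Real.sqrt (∑ i, ‖f i‖ ^ 2) * Real.sqrt (∑ i, ‖v i‖ ^ 2) := by
  calc ‖∑ i, star (f i) * v i‖ ≤ ∑ i, ‖star (f i) * v i‖ := norm_sum_le _ _
    _ = ∑ i, ‖f i‖ * ‖v i‖ := Finset.sum_congr rfl fun i _ => by rw [norm_mul, norm_star]
    _ ≤ Real.sqrt (∑ i, ‖f i‖ ^ 2) * Real.sqrt (∑ i, ‖v i‖ ^ 2) := Real.sum_mul_le_sqrt_mul_sqrt _ _ _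

/-- ★ **THE BILINEAR ROW**: `‖Σ_i f̄_i (X g)_i‖ ≤ ‖X‖·√(Σ‖f_i‖²)·√(Σ‖g_i‖²)` — with `X := P_U − P_1^{g}` (§2) and `f = g := D*_U A_j` this is the `ε₀R″`-part of
Step I.2 (L5″) `|⟨A_j, (D P D* − D P′ D*) A_j⟩| ≤ ‖P − P′‖·‖D*A_j‖²` (`≤ ‖P − P′‖·𝔥(A_j)`). [cite: Balaban1985BackgroundPropagators, (3.49) p.399] -/
theorem norm_sum_star_mul_mulVec_le (X : Matrix n n ℂ) (f g : n → ℂ) :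
    ‖∑ i, star (f i) * (X *ᵥ g) i‖ ≤ ‖X‖ * Real.sqrt (∑ i, ‖f i‖ ^ 2) * Real.sqrt (∑ i, ‖g i‖ ^ 2) := by
  calc ‖∑ i, star (f i) * (X *ᵥ g) i‖ ≤ Real.sqrt (∑ i, ‖f i‖ ^ 2) * Real.sqrt (∑ i, ‖(X *ᵥ g) i‖ ^ 2) := norm_sum_star_mul_le_sqrt_mul_sqrt f _
    _ ≤ Real.sqrt (∑ i, ‖f i‖ ^ 2) * (‖X‖ * Real.sqrt (∑ i, ‖g i‖ ^ 2)) := mul_le_mul_of_nonneg_left (sqrt_normSq_mulVec_le X g) (Real.sqrt_nonneg _)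
    _ = ‖X‖ * Real.sqrt (∑ i, ‖f i‖ ^ 2) * Real.sqrt (∑ i, ‖g i‖ ^ 2) := by ring

end Summit.QuantumFields.YangMills.Theorems.Prop7ProjectorPerturbation

end
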